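import Summits.FinalStateConjecture.FinalStateConjecture.Theorems.SwallowTheDatumParametricKerrBurialStubTransportPatchB
import Literature.Geometry.Lorentzian.AFEndDilationDecay

/-!
# `ParametricKerrBurial`, line `receding-annulus-universal-collar` — stub
# `stub_endRescaling_of_chartDatum` (A2a2) (crux item stmt-FinalStateConjecture-10052)

The registered stub `stub_endRescaling_of_chartDatum`, proved. Input: ONE datum `I₀` on `E3 = ℝ³`
which IS the chart data `(hCoeff e d, kCoeff e d)` of a Dafermos–Rodnianski end `e` of `d` on
`{2 e.R ≤ ‖y‖}` and is vacuum on `{2 e.R < ‖y‖}` (the neighbour stub A2a1). Output: the unit-scale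
input family of the annular gluing, the inverse dilates

  `I R := I₀.dilateFamily R⁻¹`,  `coordH (I R) y = coordH I₀ (R y)`,
  `coordK (I R) y = R · coordK I₀ (R y)`

(`InitialDataDilation.lean`), together with

* joint smoothness of its sections on `{R⋆ < R} × {1/2 < ‖y‖}` (indeed on `{0 < R} × E3`:
  `contMDiffAt_dilateFamily_h/k` composed with the smooth `(R, y) ↦ (R⁻¹, y)`);
* vacuum on `{1/2 < ‖y‖}` for `R > R⋆ ≥ 4 e.R` (diffeomorphism equivariance and homothety
  covariance of the constraint map, `vacuumOn_dilate`, verbatim the computation of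
  `stub_collarDilationB`; Bartnik–Isenberg 2004, §2);
* the chart reading `coordH (I R) y = hCoeff e d (R y)`, `coordK (I R) y = R kCoeff e d (R y)` on
  `{1/2 < ‖y‖}`;
* sup-`C² × C¹` `δ₀`-smallness of `(coordH (I R) − δ, coordK (I R))` on the shell `{1 ≤ ‖y‖ ≤ 4}`
  for `R > R⋆(δ₀)`: by `IsAsymptoticallyFlat_one_holds` the end has `|∂^m (h − δ)| ≤ C r^{-1-m}`
  (`m ≤ 2`) and `|∂^m k| ≤ C r^{-2-m}` (`m ≤ 1`) beyond some radius
  (`exists_uniform_bound_of_isBigO`),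
  and under `y ↦ R y` the `m`-th derivative scales by at most `R^m`
  (`norm_iteratedFDeriv_comp_smul_le`, chain rule for a linear change of variables), so that on the
  shell both quantities are `≤ C/R` (`pow_mul_rpow_le_inv`).

References: Bartnik–Isenberg 2004, §2 (covariance of the constraints); Dafermos–Rodnianski 2013,
App. B.2.3 (the decay of the end); Corvino 2000, §4 (rescaling the far region to unit scale before
gluing).
-/

-- the doubled `FinalStateConjecture` path component is the summit/problem naming scheme,
-- not a mistake
set_option linter.dupNamespace false
-- instance search through the nested operator type `E3 →L[ℝ] E3 →L[ℝ] ℝ` (as in the tree files)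
set_option maxSynthPendingDepth 3

noncomputable section

namespace Summit.FinalStateConjecture.FinalStateConjecture.Theorems.SwallowTheDatum.ParametricKerrBurial

open scoped Manifold ContDiff Topology
-- NB: no `open Bundle` (instance synthesis time-outs on `‖iteratedFDeriv …‖` of chart components).
open Set Filter Function Bornology Asymptotics Literature.Geometry.Lorentzian

/-! ## §1 Elementary analysis on `ℝ³` -/

section Analysis

/-- Extraction of a radius from an eventual statement along `Bornology.cobounded E3`. [folklore] -/
theorem exists_radius_of_eventually_cobounded {P : E3 → Prop} (h : ∀ᶠ x in cobounded E3, P x) :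
    ∃ r : ℝ, ∀ x : E3, r ≤ ‖x‖ → P x := by
  rw [← comap_norm_atTop, eventually_comap, eventually_atTop] at h
  obtain ⟨r, hr⟩ := h
  exact ⟨r, fun x hx ↦ hr ‖x‖ hx x rfl⟩

/-- **One constant and one radius for finitely many `O`-bounds at infinity**: if
`f m = O(g m)` along `cobounded E3` for each `m ≤ n`, then `‖f m x‖ ≤ C ‖g m x‖` for all `m ≤ n`
and all `‖x‖ ≥ r`, for some `C > 0` and `r`. [folklore] -/
theorem exists_uniform_bound_of_isBigO {n : ℕ} {f g : ℕ → E3 → ℝ}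
    (h : ∀ m ≤ n, f m =O[cobounded E3] g m) :
    ∃ C r : ℝ, 0 < C ∧ ∀ m ≤ n, ∀ x : E3, r ≤ ‖x‖ → ‖f m x‖ ≤ C * ‖g m x‖ := by
  induction n with
  | zero =>
    obtain ⟨C, hC, hCb⟩ := (h 0 le_rfl).exists_pos
    obtain ⟨r, hr⟩ := exists_radius_of_eventually_cobounded hCb.bound
    refine ⟨C, r, hC, fun m hm x hx ↦ ?_⟩
    obtain rfl := Nat.le_zero.1 hm
    exact hr x hx
  | succ n ih =>
    obtain ⟨C, r, hC, hb⟩ := ih fun m hm ↦ h m (hm.trans n.le_succ)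
    obtain ⟨C', -, hCb'⟩ := (h (n + 1) le_rfl).exists_pos
    obtain ⟨r', hr'⟩ := exists_radius_of_eventually_cobounded hCb'.bound
    refine ⟨max C C', max r r', lt_max_of_lt_left hC, fun m hm x hx ↦ ?_⟩
    rcases Nat.of_le_succ hm with hm | rfl
    · exact (hb m hm x ((le_max_left _ _).trans hx)).trans
        (mul_le_mul_of_nonneg_right (le_max_left _ _) (norm_nonneg _))
    · exact (hr' x ((le_max_right _ _).trans hx)).trans
        (mul_le_mul_of_nonneg_right (le_max_right _ _) (norm_nonneg _))

/-- The same for power bounds on iterated derivatives: `‖D^m F(x)‖ ≤ C ‖x‖^{s m}` for `m ≤ n` and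
`‖x‖ ≥ r`. [folklore] -/
theorem exists_uniform_bound_iteratedFDeriv {V : Type*} [NormedAddCommGroup V] [NormedSpace ℝ V]
    {n : ℕ} {F : E3 → V} {s : ℕ → ℝ}
    (h : ∀ m ≤ n, (fun x ↦ ‖iteratedFDeriv ℝ m F x‖) =O[cobounded E3] fun x ↦ ‖x‖ ^ (s m)) :
    ∃ C r : ℝ, 0 < C ∧ ∀ m ≤ n, ∀ x : E3, r ≤ ‖x‖ →
      ‖iteratedFDeriv ℝ m F x‖ ≤ C * ‖x‖ ^ (s m) := by
  obtain ⟨C, r, hC, hb⟩ := exists_uniform_bound_of_isBigO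
    (f := fun m x ↦ ‖iteratedFDeriv ℝ m F x‖) (g := fun m x ↦ ‖x‖ ^ (s m)) h
  refine ⟨C, r, hC, fun m hm x hx ↦ ?_⟩
  have := hb m hm x hx
  rwa [norm_norm, Real.norm_of_nonneg (Real.rpow_nonneg (norm_nonneg x) _)] at this

/-- The `rpow` bookkeeping of the rescaling: `R^j t^s ≤ R⁻¹` for `1 ≤ R ≤ t` and `s ≤ -j - 1`.
[folklore] -/
theorem pow_mul_rpow_le_inv {R t s : ℝ} {j : ℕ} (hR : 1 ≤ R) (ht : R ≤ t)
    (hs : s ≤ -(j : ℝ) - 1) : R ^ j * t ^ s ≤ R⁻¹ := by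
  have hR0 : 0 < R := one_pos.trans_le hR
  have ht1 : 1 ≤ t := hR.trans ht
  have ht0 : 0 < t := one_pos.trans_le ht1
  have h1 : t ^ s ≤ (t ^ (j + 1))⁻¹ := by
    calc t ^ s ≤ t ^ (-(j : ℝ) - 1) := Real.rpow_le_rpow_of_exponent_le ht1 hs
      _ = (t ^ (j + 1))⁻¹ := by
        rw [show (-(j : ℝ) - 1) = -((j + 1 : ℕ) : ℝ) by push_cast; ring, Real.rpow_neg ht0.le,
          Real.rpow_natCast]
  have h2 : (t ^ (j + 1))⁻¹ ≤ (R ^ (j + 1))⁻¹ :=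
    inv_anti₀ (pow_pos hR0 _) (pow_le_pow_left₀ hR0.le ht _)
  calc R ^ j * t ^ s ≤ R ^ j * (R ^ (j + 1))⁻¹ :=
        mul_le_mul_of_nonneg_left (h1.trans h2) (pow_nonneg hR0.le _)
    _ = R⁻¹ := by
        rw [pow_succ, mul_inv, ← mul_assoc, mul_inv_cancel₀ (pow_pos hR0 _).ne', one_mul]

/-- **Scaling of iterated derivatives under `y ↦ R y`**: `‖D^m (F ∘ (R ·))(x)‖ ≤ R^m ‖D^m F(R x)‖`
(chain rule for the linear change of variables `R · id`, of operator norm `R`;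
`ContinuousLinearEquiv.iteratedFDerivWithin_comp_right`, no differentiability needed). [folklore] -/
theorem norm_iteratedFDeriv_comp_smul_le {V : Type*} [NormedAddCommGroup V] [NormedSpace ℝ V]
    (F : E3 → V) {R : ℝ} (hR : 0 < R) (m : ℕ) (x : E3) :
    ‖iteratedFDeriv ℝ m (fun y ↦ F (R • y)) x‖ ≤ R ^ m * ‖iteratedFDeriv ℝ m F (R • x)‖ := by
  set L : E3 ≃L[ℝ] E3 := InitialDataSet.shrinkCLE (inv_ne_zero hR.ne') with hL
  have hLapp : ∀ y, L y = R • y := fun y ↦ by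
    show R⁻¹⁻¹ • y = R • y
    rw [inv_inv]
  have hfun : (fun y ↦ F (R • y)) = F ∘ L := by
    funext y
    rw [comp_apply, hLapp]
  have hcomp : iteratedFDeriv ℝ m (fun y ↦ F (R • y)) x =
      (iteratedFDeriv ℝ m F (R • x)).compContinuousLinearMap fun _ ↦ (L : E3 →L[ℝ] E3) := by
    have h := L.iteratedFDerivWithin_comp_right F uniqueDiffOn_univ (mem_univ (L x)) m
    rw [preimage_univ, iteratedFDerivWithin_univ, iteratedFDerivWithin_univ, hLapp x] at h
    rw [hfun]
    exact h
  have hLnorm : ‖(L : E3 →L[ℝ] E3)‖ ≤ R := by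
    refine ContinuousLinearMap.opNorm_le_bound _ hR.le fun v ↦ ?_
    rw [show (L : E3 →L[ℝ] E3) v = R • v from hLapp v, norm_smul, Real.norm_of_nonneg hR.le]
  rw [hcomp]
  refine (ContinuousMultilinearMap.norm_compContinuousLinearMap_le _ _).trans ?_
  rw [Finset.prod_const, Finset.card_univ, Fintype.card_fin, mul_comm]
  exact mul_le_mul_of_nonneg_right (pow_le_pow_left₀ (norm_nonneg _) hLnorm m) (norm_nonneg _)

/-- **The rescaled decay estimate.** If `G = F` beyond radius `ρ`, `‖D^m F(x)‖ ≤ C ‖x‖^s` beyond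
radius `r`, `s ≤ -j - 1` and `a R^m ≤ R^j`, then on the shell `{1 ≤ ‖y‖}` and for
`R ≥ max 1 r`, `R > ρ`, `C ≤ R δ`: `a ‖D^m (G ∘ (R ·))(y)‖ ≤ δ` (locality of `iteratedFDeriv`, the
scaling `norm_iteratedFDeriv_comp_smul_le`, and `pow_mul_rpow_le_inv`: the bound is `≤ C/R`).
[folklore] -/
theorem mul_norm_iteratedFDeriv_comp_smul_le {V : Type*} [NormedAddCommGroup V] [NormedSpace ℝ V]
    {F G : E3 → V} {ρ r C s R a δ : ℝ} {m j : ℕ} {y : E3}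
    (hGF : ∀ w : E3, ρ < ‖w‖ → G w = F w)
    (hb : ∀ x : E3, r ≤ ‖x‖ → ‖iteratedFDeriv ℝ m F x‖ ≤ C * ‖x‖ ^ s)
    (hC : 0 ≤ C) (hs : s ≤ -(j : ℝ) - 1) (ha : a * R ^ m ≤ R ^ j) (ha0 : 0 ≤ a)
    (hR1 : 1 ≤ R) (hr : r ≤ R) (hρ : ρ < R) (hy : 1 ≤ ‖y‖) (hCR : C ≤ R * δ) :
    a * ‖iteratedFDeriv ℝ m (fun z ↦ G (R • z)) y‖ ≤ δ := by
  have hR0 : 0 < R := one_pos.trans_le hR1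
  have hRy : R ≤ ‖R • y‖ := by
    rw [norm_smul, Real.norm_of_nonneg hR0.le]
    exact le_mul_of_one_le_right hR0.le hy
  -- locality of the iterated derivative: `G = F` near `R y`
  have hloc : iteratedFDeriv ℝ m G (R • y) = iteratedFDeriv ℝ m F (R • y) := by
    refine (Filter.EventuallyEq.iteratedFDeriv ℝ ?_ m).eq_of_nhds
    filter_upwards [(isOpen_lt continuous_const continuous_norm).mem_nhds (hρ.trans_le hRy)]
      with w hw
    exact hGF w hw
  calc a * ‖iteratedFDeriv ℝ m (fun z ↦ G (R • z)) y‖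
      ≤ a * (R ^ m * ‖iteratedFDeriv ℝ m G (R • y)‖) :=
        mul_le_mul_of_nonneg_left (norm_iteratedFDeriv_comp_smul_le G hR0 m y) ha0
    _ ≤ a * (R ^ m * (C * ‖R • y‖ ^ s)) := by
        rw [hloc]
        exact mul_le_mul_of_nonneg_left
          (mul_le_mul_of_nonneg_left (hb _ (hr.trans hRy)) (pow_nonneg hR0.le _)) ha0
    _ = a * R ^ m * ‖R • y‖ ^ s * C := by ring
    _ ≤ R ^ j * ‖R • y‖ ^ s * C :=
        mul_le_mul_of_nonneg_right
          (mul_le_mul_of_nonneg_right ha (Real.rpow_nonneg (norm_nonneg _) _)) hC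
    _ ≤ R⁻¹ * C := mul_le_mul_of_nonneg_right (pow_mul_rpow_le_inv hR1 hRy hs) hC
    _ ≤ δ := by
        rw [inv_mul_le_iff₀ hR0]
        exact hCR

end Analysis

/-! ## §2 The inverse dilation family `R ↦ I₀.dilateFamily R⁻¹` -/

section Family

variable (I₀ : InitialDataSet (𝓡 3) E3)

/-- The metric of the inverse dilate: `coordH (I₀.dilateFamily R⁻¹) y = coordH I₀ (R y)`.
[cite: BartnikIsenberg2004, §2] -/
theorem coordH_dilateFamily_inv {R : ℝ} (hR : 0 < R) (y : E3) :
    (I₀.dilateFamily R⁻¹).coordH y = I₀.coordH (R • y) := by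
  rw [I₀.dilateFamily_of_pos (inv_pos.2 hR), I₀.coordH_dilate, inv_inv]

/-- The tensor `k` of the inverse dilate: `coordK (I₀.dilateFamily R⁻¹) y = R · coordK I₀ (R y)`.
[cite: BartnikIsenberg2004, §2] -/
theorem coordK_dilateFamily_inv {R : ℝ} (hR : 0 < R) (y : E3) :
    (I₀.dilateFamily R⁻¹).coordK y = R • I₀.coordK (R • y) := by
  rw [I₀.dilateFamily_of_pos (inv_pos.2 hR), I₀.coordK_dilate, inv_inv]

/-- **Joint smoothness of the inverse dilation family** on any `s ⊆ {0 < R} × E3`: the sections of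
`(R, y) ↦ I₀.dilateFamily R⁻¹` are those of the dilation family (`contMDiffAt_dilateFamily_h/k`)
composed with the smooth map `(R, y) ↦ (R⁻¹, y)`. [folklore] -/
theorem smoothSectionsOn_dilateFamily_inv (s : Set (ℝ × E3)) (hs : ∀ p ∈ s, 0 < p.1) :
    SmoothSectionsOn 𝓘(ℝ, ℝ) (fun R ↦ I₀.dilateFamily R⁻¹) s := by
  have hφ : ∀ p : ℝ × E3, 0 < p.1 →
      ContMDiffAt (𝓘(ℝ, ℝ).prod (𝓡 3)) (𝓘(ℝ, ℝ).prod (𝓡 3)) ∞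
        (fun q : ℝ × E3 ↦ (q.1⁻¹, q.2)) p :=
    fun p hp ↦ (InitialDataSet.contMDiffAt_inv_fst hp.ne').prodMk contMDiffAt_snd
  refine ⟨fun p hp ↦ ?_, fun p hp ↦ ?_⟩
  · exact ((I₀.contMDiffAt_dilateFamily_h (p := (p.1⁻¹, p.2)) (inv_pos.2 (hs p hp))).comp p
      (hφ p (hs p hp))).contMDiffWithinAt
  · exact ((I₀.contMDiffAt_dilateFamily_k (p := (p.1⁻¹, p.2)) (inv_pos.2 (hs p hp))).comp p
      (hφ p (hs p hp))).contMDiffWithinAt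

/-- **Dilation covariance of the vacuum constraints, localised**: if `C` solves the vacuum
constraints on `s` then `C.dilate l` solves them on any `t` with `t/l ⊆ s` (diffeomorphism
equivariance `hamiltonianConstraintFn_comap`, `momentumConstraintFn_comap_apply` and homothety
covariance `hamiltonianConstraintFn_homothety`, `momentumConstraintFn_homothety` of the constraint
map, pointwise). Bartnik–Isenberg 2004, §2. [cite: BartnikIsenberg2004, §2] -/
theorem vacuumOn_dilate (C : InitialDataSet (𝓡 3) E3) {s t : Set E3} (hC : VacuumOn s C) {l : ℝ}
    (hl : 0 < l) (hst : ∀ y ∈ t, l⁻¹ • y ∈ s) : VacuumOn t (C.dilate l hl) := by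
  intro inst y hy
  haveI hC' : C.metric.HasLeviCivita := C.metric.hasLeviCivita
  haveI hCc : (C.comap (InitialDataSet.shrinkCLM l) (InitialDataSet.contMDiff_shrinkCLM l)
      (InitialDataSet.injective_mfderiv_shrinkCLM hl.ne')).metric.HasLeviCivita :=
    (C.comap (InitialDataSet.shrinkCLM l) (InitialDataSet.contMDiff_shrinkCLM l)
      (InitialDataSet.injective_mfderiv_shrinkCLM hl.ne')).metric.hasLeviCivita
  haveI : ((C.comap (InitialDataSet.shrinkCLM l) (InitialDataSet.contMDiff_shrinkCLM l)
      (InitialDataSet.injective_mfderiv_shrinkCLM hl.ne')).homothety l hl).metric.HasLeviCivita :=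
    inst
  have hy' : InitialDataSet.shrinkCLM l y ∈ s := by
    rw [InitialDataSet.shrinkCLM_apply]
    exact hst y hy
  obtain ⟨hH, hM⟩ := hC (InitialDataSet.shrinkCLM l y) hy'
  change ((C.comap (InitialDataSet.shrinkCLM l) (InitialDataSet.contMDiff_shrinkCLM l)
      (InitialDataSet.injective_mfderiv_shrinkCLM hl.ne')).homothety l hl).hamiltonianConstraintFn
        y = 0 ∧
    ((C.comap (InitialDataSet.shrinkCLM l) (InitialDataSet.contMDiff_shrinkCLM l)
      (InitialDataSet.injective_mfderiv_shrinkCLM hl.ne')).homothety l hl).momentumConstraintFn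
        y = 0
  refine ⟨?_, ?_⟩
  · rw [InitialDataSet.hamiltonianConstraintFn_homothety,
      InitialDataSet.hamiltonianConstraintFn_comap C (InitialDataSet.contMDiff_shrinkCLM l)
        (InitialDataSet.injective_mfderiv_shrinkCLM hl.ne') rfl, hH, mul_zero]
  · rw [InitialDataSet.momentumConstraintFn_homothety]
    refine smul_eq_zero_of_right _ (LinearMap.ext fun Y₀ ↦ ?_)
    rw [InitialDataSet.momentumConstraintFn_comap_apply C (InitialDataSet.contMDiff_shrinkCLM l)
      (InitialDataSet.injective_mfderiv_shrinkCLM hl.ne') rfl y (C.mdifferentiableAt_traceK _),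
      hM]
    rfl

end Family

/-! ## §3 The stub -/

/-- **Stub `stub_endRescaling_of_chartDatum`** (registered signature, line
`receding-annulus-universal-collar`, crux item stmt-FinalStateConjecture-10052). The inverse dilates
`I R := I₀.dilateFamily R⁻¹` of a datum `I₀` on `ℝ³` reading a Dafermos–Rodnianski end `e` of `d`
beyond `2 e.R`: jointly smooth on `{R⋆ < R} × {1/2 < ‖y‖}` (`smoothSectionsOn_dilateFamily_inv`),
vacuum on `{1/2 < ‖y‖}` (`vacuumOn_dilate`), the chart reading (`coordH/K_dilateFamily_inv`), and
sup-`C² × C¹` `δ₀`-close to `(δ, 0)` on `{1 ≤ ‖y‖ ≤ 4}` once `R > R⋆(δ₀) ≥ max 1 (4 e.R)`: the end is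
asymptotically flat of order `1` (`IsAsymptoticallyFlat_one_holds`), the `m`-th derivative scales by
at most `R^m` under `y ↦ R y` (`norm_iteratedFDeriv_comp_smul_le`), so both bounds are `≤ C/R`
(`pow_mul_rpow_le_inv`). Dafermos–Rodnianski 2013, App. B.2.3; Bartnik–Isenberg 2004, §2;
Corvino 2000, §4. [folklore] -/
theorem stub_endRescaling_of_chartDatum :
    ∀ (X : Type) [TopologicalSpace X] [ChartedSpace E3 X] [IsManifold (𝓡 3) ∞ X] [T2Space X]
      [SecondCountableTopology X] [ConnectedSpace X] (d : InitialDataSet (𝓡 3) X) (e : AFEnd X) (M : ℝ)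
      (I₀ : InitialDataSet (𝓡 3) E3),
      e.IsStronglyAsymptoticallyFlatDR d M → VacuumOn {y | 2 * e.R < ‖y‖} I₀ →
      (∀ y : E3, 2 * e.R ≤ ‖y‖ → I₀.coordH y = AFEnd.hCoeff e d y ∧ I₀.coordK y = AFEnd.kCoeff e d y) →
      ∀ δ₀ : ℝ, 0 < δ₀ →
      ∃ (Rstar : ℝ) (I : ℝ → InitialDataSet (𝓡 3) E3),
        e.R < Rstar ∧ 1 ≤ Rstar ∧
        SmoothSectionsOn 𝓘(ℝ, ℝ) I {p : ℝ × E3 | Rstar < p.1 ∧ 1 / 2 < ‖p.2‖} ∧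
        (∀ R : ℝ, Rstar < R → VacuumOn {y | 1 / 2 < ‖y‖} (I R)) ∧
        (∀ R : ℝ, Rstar < R → ∀ y : E3, 1 / 2 < ‖y‖ →
          (I R).coordH y = AFEnd.hCoeff e d (R • y) ∧ (I R).coordK y = R • AFEnd.kCoeff e d (R • y)) ∧
        (∀ R : ℝ, Rstar < R → ∀ y : E3, 1 ≤ ‖y‖ → ‖y‖ ≤ 4 →
          (∀ i ≤ 2, ‖iteratedFDeriv ℝ i
              (fun z : E3 ↦ (I R).coordH z - (innerSL ℝ : E3 →L[ℝ] E3 →L[ℝ] ℝ)) y‖ ≤ δ₀) ∧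
          (∀ i ≤ 1, ‖iteratedFDeriv ℝ i (I R).coordK y‖ ≤ δ₀)) := by
  intro X _ _ _ _ _ _ d e M I₀ hDR hvac hchart δ₀ hδ₀
  -- the decay of the end: asymptotic flatness of order `1`, turned into one constant and one radius
  have hAF : AFEnd.IsAsymptoticallyFlat e d 1 :=
    AFEnd.IsStronglyAsymptoticallyFlatDR.IsAsymptoticallyFlat_one_holds e d hDR
  -- `F = hCoeff e d − δ` (the decaying quantity) and `G = coordH I₀ − δ` (agreeing beyond `2 e.R`),
  -- as opaque functions
  obtain ⟨F, hF⟩ : ∃ F : E3 → E3 →L[ℝ] E3 →L[ℝ] ℝ,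
      F = fun w ↦ AFEnd.hCoeff e d w - (innerSL ℝ : E3 →L[ℝ] E3 →L[ℝ] ℝ) := ⟨_, rfl⟩
  obtain ⟨G, hG⟩ : ∃ G : E3 → E3 →L[ℝ] E3 →L[ℝ] ℝ,
      ∀ w, G w = I₀.coordH w - (innerSL ℝ : E3 →L[ℝ] E3 →L[ℝ] ℝ) := ⟨_, fun w ↦ rfl⟩
  have hGF : ∀ w : E3, 2 * e.R < ‖w‖ → G w = F w := fun w hw ↦ by
    rw [hG, hF, (hchart w hw.le).1]
  have hh : ∀ m ≤ 2, (fun x ↦ ‖iteratedFDeriv ℝ m F x‖) =O[cobounded E3]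
      fun x ↦ ‖x‖ ^ (-(1 : ℝ) - m) := by
    rw [hF]
    exact hAF.1
  have hk : ∀ m ≤ 1, (fun x ↦ ‖iteratedFDeriv ℝ m (AFEnd.kCoeff e d) x‖) =O[cobounded E3]
      fun x ↦ ‖x‖ ^ (-(1 : ℝ) - 1 - m) := hAF.2
  obtain ⟨Ch, rh, hCh, hbh⟩ := exists_uniform_bound_iteratedFDeriv hh
  obtain ⟨Ck, rk, hCk, hbk⟩ := exists_uniform_bound_iteratedFDeriv hk
  have heR := e.R_pos
  -- the threshold radius
  obtain ⟨Rstar, hRstar1, hRstarR, key⟩ : ∃ Rstar : ℝ, 1 ≤ Rstar ∧ e.R < Rstar ∧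
      ∀ R : ℝ, Rstar < R →
        1 < R ∧ 4 * e.R < R ∧ rh ≤ R ∧ rk ≤ R ∧ Ch < R * δ₀ ∧ Ck < R * δ₀ := by
    refine ⟨max (max 1 (4 * e.R)) (max (max rh rk) (max Ch Ck / δ₀)),
      le_max_of_le_left (le_max_left _ _), lt_max_of_lt_left (lt_max_of_lt_right (by linarith)),
      fun R hR ↦ ?_⟩
    simp only [max_lt_iff, div_lt_iff₀ hδ₀] at hR
    obtain ⟨⟨hR1, hR4⟩, ⟨hrh, hrk⟩, hCh', hCk'⟩ := hR
    exact ⟨hR1, hR4, hrh.le, hrk.le, hCh', hCk'⟩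
  refine ⟨Rstar, fun R ↦ I₀.dilateFamily R⁻¹, hRstarR, hRstar1, ?_, ?_, ?_, ?_⟩
  · -- joint smoothness on `{Rstar < R} × {1/2 < ‖y‖} ⊆ {0 < R} × E3`
    exact smoothSectionsOn_dilateFamily_inv I₀ _ fun p hp ↦ one_pos.trans (hRstar1.trans_lt hp.1)
  · -- vacuum on `{1/2 < ‖y‖}`: there `R y ∈ {2 e.R < ‖·‖}`
    intro R hR
    obtain ⟨hR1, hR4, -, -, -, -⟩ := key R hR
    have hR0 : 0 < R := one_pos.trans hR1
    show VacuumOn {y : E3 | 1 / 2 < ‖y‖} (I₀.dilateFamily R⁻¹)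
    rw [I₀.dilateFamily_of_pos (inv_pos.2 hR0)]
    refine vacuumOn_dilate I₀ hvac (inv_pos.2 hR0) fun y hy ↦ ?_
    show 2 * e.R < ‖R⁻¹⁻¹ • y‖
    rw [inv_inv, norm_smul, Real.norm_of_nonneg hR0.le]
    change 1 / 2 < ‖y‖ at hy
    nlinarith
  · -- the chart reading on `{1/2 < ‖y‖}`
    intro R hR y hy
    obtain ⟨hR1, hR4, -, -, -, -⟩ := key R hR
    have hR0 : 0 < R := one_pos.trans hR1
    have hRy : 2 * e.R ≤ ‖R • y‖ := by
      rw [norm_smul, Real.norm_of_nonneg hR0.le]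
      nlinarith
    obtain ⟨h1, h2⟩ := hchart (R • y) hRy
    refine ⟨?_, ?_⟩
    · show (I₀.dilateFamily R⁻¹).coordH y = _
      rw [coordH_dilateFamily_inv I₀ hR0, h1]
    · show (I₀.dilateFamily R⁻¹).coordK y = _
      rw [coordK_dilateFamily_inv I₀ hR0, h2]
  · -- smallness on the shell `{1 ≤ ‖y‖ ≤ 4}`
    intro R hR y hy1 _hy4
    obtain ⟨hR1, hR4, hrh, hrk, hCh', hCk'⟩ := key R hR
    have hR0 : 0 < R := one_pos.trans hR1
    have hR2 : 2 * e.R < R := by linarith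
    refine ⟨fun i hi ↦ ?_, fun i hi ↦ ?_⟩
    · -- the metric: `coordH (I R) − δ = G ∘ (R ·)`, `G = coordH I₀ − δ = F` beyond `2 e.R`
      have hfun :
          (fun z : E3 ↦ (I₀.dilateFamily R⁻¹).coordH z - (innerSL ℝ : E3 →L[ℝ] E3 →L[ℝ] ℝ)) =
            fun z ↦ G (R • z) := by
        funext z
        rw [coordH_dilateFamily_inv I₀ hR0, hG]
      show ‖iteratedFDeriv ℝ i
        (fun z : E3 ↦ (I₀.dilateFamily R⁻¹).coordH z - (innerSL ℝ : E3 →L[ℝ] E3 →L[ℝ] ℝ)) y‖ ≤ δ₀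
      rw [hfun, ← one_mul ‖iteratedFDeriv ℝ i (fun z ↦ G (R • z)) y‖]
      exact mul_norm_iteratedFDeriv_comp_smul_le (j := i) hGF (hbh i hi) hCh.le (by linarith)
        (by rw [one_mul]) zero_le_one hR1.le hrh hR2 hy1 hCh'.le
    · -- the second fundamental form: `coordK (I R) = R · (coordK I₀ ∘ (R ·))`, and
      -- `coordK I₀ = kCoeff e d` beyond `2 e.R`
      have hfun : (I₀.dilateFamily R⁻¹).coordK = R • fun w ↦ I₀.coordK (R • w) := by
        funext z
        rw [Pi.smul_apply]
        exact coordK_dilateFamily_inv I₀ hR0 z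
      have hdiff : ContDiff ℝ ∞ (fun w : E3 ↦ I₀.coordK (R • w)) :=
        I₀.contMDiff_coordK.contDiff.comp (contDiff_const_smul R)
      show ‖iteratedFDeriv ℝ i (I₀.dilateFamily R⁻¹).coordK y‖ ≤ δ₀
      rw [hfun,
        iteratedFDeriv_const_smul_apply (hdiff.contDiffAt.of_le (by exact_mod_cast le_top)),
        norm_smul, Real.norm_of_nonneg hR0.le]
      exact mul_norm_iteratedFDeriv_comp_smul_le (F := AFEnd.kCoeff e d) (G := I₀.coordK)
        (j := i + 1) (fun w hw ↦ (hchart w hw.le).2) (hbk i hi) hCk.le (by push_cast; linarith)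
        (pow_succ' R i).symm.le hR0.le hR1.le hrk hR2 hy1 hCk'.le

end Summit.FinalStateConjecture.FinalStateConjecture.Theorems.SwallowTheDatum.ParametricKerrBurial

end
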